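/-
Copyright (c) 2026 the pub-hodgecm-mathlib formalisation cell (harness21).  Prover seat hodgecm-mathlib-LH4-p13 (g3), req620 Track A «(D-RAM) FOUR-FRAME» squad
(heir LEAD F0P3a-plan lineage; dealer LH4-plan (g11) WORD #52 (b) «κG₂ G₂∕G₃-κ BY ROTATION — the `kappaCount` permutation rule is your first file»; κ-road of unit U3_Laws,
the (κ-B₀)∕(κ-B₂) children of `Cruxes/H413/Lines/F0_P3c_DyRamFourFrame_U3_Laws.lean` ED. 10).  2026-09-04.
-/
import Summits.HodgeConjecture.HodgeConjecture.Theorems.F0P3cDyRamDiagonalPermutationTwo   -- ★ §P₂ ED. 2 (this lineage, p856500): `image_polarisationCosets_mapGL_perm`, `image_mapGL_stratumTwo`, `stabiliserWeight_mapGL_perm`, `coe_conj_eq_diagonal`, `isElementDatum_swap∕_rescale`, `stratum(Two)_eq_of_coe_eq_smul`; brings ★ §P, ★ StrataDefs ED. 3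
import Summits.HodgeConjecture.HodgeConjecture.Theorems.F0P3cDyRamDiagonalKappaCountDefs    -- ★ Fκ1 (LH4-p05 (g3), p856497): `chiVec`, `cosetKappa`, `kappaCount`
import HarnessLib

/-!
# Crux `H413`, «(D-RAM) FOUR-FRAME» road, unit U3_Laws, κ-STAGE B: «THE κ-COUNT UNDER A COORDINATE PERMUTATION» — `kappaCount σ ϖ tv i (P·M) = kappaCount σ ϖ tv (π i) M`
# and the slot-permuting G₂∕G₃ (and T₂∕T₃) adapters for ANY κ-weighted stratum head, types 0 and 2

Cell `hodgecm-mathlib` (D-0151), FLOOR 0, crux item H413 = `stmt-HodgeConjecture-24833`; lane `--supports stmt-HodgeConjecture-24833 --as helper` (count-neutral).  THEOREMS ONLY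
(no `def`, no instance, no notation, no `sorry`).  The κ-Stage-B children (κ-B₀) `stub_U3_kappaCount_typeZero` ∕ (κ-B₂) `stub_U3_kappaCount_typeTwo_mult` (U3 ED. 10) sum the SIGNED
weight `(kappaCount σ ϖ tv i M : ℚ) * stabiliserWeight σ M` over the strata; unlike the multiplicity `polarisationCount` (★ §P₂ ED. 2 `polarisationCount_mapGL_perm`: INVARIANT), the
signed κ-count is EQUIVARIANT in the slot: a coordinate permutation `P = π.permMatrix` moves the polarisation cosets by `D ↦ D ∘ π⁻¹` (★ `image_polarisationCosets_mapGL_perm`) and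
`χ_i(D ∘ π) = Π_{j ≠ i} ω(D_{π j}) = χ_{π i}(D)`.  THIS FILE (dealer WORD #52 (b): «if ★ Fκ2∕KappaCountDefs lacks `kappaCount_reindex`-type lemmas, that lemma is your first file»):
* §1 `chiVec_mul_normSign_eq_prod` (`χ_i(D)·ω(D_i) = Π_j ω(D_j)`, since `ω² = 1`), **`chiVec_comp_perm`** `chiVec σ i (D ∘ π) = chiVec σ (π i) D`, `cosetKappa_image_comp_perm`.
* §2 **`kappaCount_mapGL_perm`** — `kappaCount σ ϖ tv i (mapGL P M) = kappaCount σ ϖ tv (π i) M` (any `tv`, any permutation of the three slots).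
* §3 EQUIVARIANT TRANSPORT over a stratum: `finsum_mem_stratum_perm_of_mapGL` ∕ `finsum_mem_stratumTwo_perm_of_mapGL` (two weights `f, g` with `f (P·M) = g M`), and the κ-instances
  **`finsum_kappaCount_mul_stabiliserWeight_stratum_perm`** (type 0) ∕ **`…_stratumTwo_perm`** (type 2): `Σᶠ_{stratum(T,a)} κ_i·w = Σᶠ_{stratum(P⁻¹TP, a∘π⁻¹)} κ_{π i}·w`.
* §4 THE SLOT-PERMUTING ADAPTERS, for a G₁∕T₁-head of ANY shape: the head is abstracted as a slot vector `F α' β' n₁' n₂' n₃' : Fin 3 → ℚ` under an arbitrary side condition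
  `Hyp α' β' n₁' n₂' n₃'` (e.g. LH4-p09 (g3)'s glue binder `hglue` with its witness `f₀`), both quantified over the element datum; then
  **`finsum_kappaCount_mul_stabiliserWeight_stratum_swap01_of`** (`(a,b,c) ↦ (b,a,c)`: value `F β α n₂ n₁ n₃ (swap 0 1 i)` under `Hyp β α n₂ n₁ n₃`),
  **`…_stratum_swap02_of`** (`(a,b,c) ↦ (c,b,a)`: value `F α⁻¹ (βα⁻¹) n₃ n₂ n₁ (swap 0 2 i)` under `Hyp α⁻¹ (βα⁻¹) n₃ n₂ n₁`), and the same two for `stratumTwo`; the named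
  G-instances `…_stratum_G2_of_G1 ∕ _G3_of_G1` (`(r, r+s, r+s) ↦ (r+s, r, r+s), (r+s, r+s, r)`, `r = 2ρ` at type 0) and `…_stratumTwo_G2_of_G1 ∕ _G3_of_G1` (`r = 2ρ+1` at type 2) —
  the κ-twins of ★ §P `finsum_stabiliserWeight_stratum_G2∕G3_of_G1` and of this lineage's ★ `GluedSocketTwoRotations`.  They turn LH4-p09 (g3)'s ★ p856706
  `finsum_kappaCount_mul_stabiliserWeight_hasAxis_G1` (type 0) and F0P3-p01 (g31)'s G₁-κ head (type 2, in flight) into the G₂∕G₃ κ-sockets by application (files `…KappaGluedRotations`,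
  `…KappaGluedTwoRotations`, next).
HONEST LABEL.  Count-neutral (`--supports`); law-free bookkeeping; the κ-census laws (KMS∕KSS children) stay PROVER TARGETS until the κ-assemblers close; `HC_CM` is proved only modulo
the 7 printed citations (2 remaining named inputs: hLiu418 = `stmt-HodgeConjecture-24832`, h413 = `stmt-HodgeConjecture-24833`) until rung 0 closes.

## References
* [Kottwitz1986BaseChangeUnits] R. E. Kottwitz, *Base change for unit elements of Hecke algebras*, Compositio Math. 60 (1986), §1 pp. 240–241 (κ-orbital integrals of units as signed
  fixed-lattice counts modulo the torus).
* [LanglandsShelstad1987] R. P. Langlands, D. Shelstad, *On the definition of transfer factors*, Math. Ann. 278 (1987), §3 (κ as a character; its behaviour under the Weyl group).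
* [Rogawski1990] J. D. Rogawski, *Automorphic Representations of Unitary Groups in Three Variables*, Ann. of Math. Stud. 123 (1990), §4.9 Prop. 4.9.1 (a) p. 55; §4.10 p. 58.
-/

set_option autoImplicit false

noncomputable section

namespace Summit.HodgeConjecture.HodgeConjecture.Cruxes.H413.F0P3cDyRamDiagonalKappaPermutation

open Matrix
open Literature.NumberTheory.Automorphic Literature.NumberTheory.Automorphic.HermitianLattice
open Literature.NumberTheory.Automorphic.UnitaryLatticeTree Literature.NumberTheory.Automorphic.UnitaryThreeFourFrame
open Summit.HodgeConjecture.HodgeConjecture.Cruxes.H413.F0P3cDyRamDiagonalTorusDefs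
open Summit.HodgeConjecture.HodgeConjecture.Cruxes.H413.F0P3cDyRamDiagonalStrataDefs
open Summit.HodgeConjecture.HodgeConjecture.Cruxes.H413.F0P3cDyRamDiagonalPermutation
open Summit.HodgeConjecture.HodgeConjecture.Cruxes.H413.F0P3cDyRamDiagonalPermutationTwo
open Summit.HodgeConjecture.HodgeConjecture.Cruxes.H413.F0P3cDyRamDiagonalKappaCountDefs
open scoped Valued WithZero Matrix MatrixGroups

/-! ## §1  `χ_i` under a permutation of the coordinates -/

section Chi

variable {K : Type} [Field K]

/-- `ω(x) ≠ 0` (`ω = normSign σ ∈ {±1}`). [cite: Rogawski1990, §4.10 p. 58] -/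
theorem normSign_ne_zero (σ : K →+* K) (x : K) : normSign σ x ≠ 0 := by
  unfold normSign; split_ifs <;> decide

/-- **`χ_i(D)·ω(D_i) = Π_j ω(D_j)`**: the slot character times the missing factor is the full product. [cite: LanglandsShelstad1987, §3] [cite: Rogawski1990, §4.10 p. 58] -/
theorem chiVec_mul_normSign_eq_prod (σ : K →+* K) (i : Fin 3) (D : Fin 3 → K) :
    chiVec σ i D * normSign σ (D i) = ∏ j, normSign σ (D j) := by
  rw [chiVec_eq, Fin.prod_univ_three]
  fin_cases i
  · simp only [Fin.zero_eta, Fin.isValue, Matrix.cons_val_zero]; ring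
  · simp only [Fin.mk_one, Fin.isValue, Matrix.cons_val_one, Matrix.cons_val_zero]; ring
  · simp only [Fin.reduceFinMk, Fin.isValue, Matrix.cons_val_two, Matrix.tail_cons, Matrix.head_cons, mul_assoc]

/-- **`χ_i(D ∘ π) = χ_{π i}(D)`** for every permutation `π` of the three slots: `Π_{j ≠ i} ω(D_{π j}) = Π_{k ≠ π i} ω(D_k)`. [cite: LanglandsShelstad1987, §3] [cite: Rogawski1990, §4.10 p. 58] -/
theorem chiVec_comp_perm (σ : K →+* K) (π : Equiv.Perm (Fin 3)) (i : Fin 3) (D : Fin 3 → K) :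
    chiVec σ i (D ∘ ⇑π) = chiVec σ (π i) D := by
  have h1 := chiVec_mul_normSign_eq_prod σ i (D ∘ ⇑π)
  have h2 := chiVec_mul_normSign_eq_prod σ (π i) D
  have hprod : ∏ j, normSign σ ((D ∘ ⇑π) j) = ∏ j, normSign σ (D j) :=
    Equiv.prod_comp π (fun j => normSign σ (D j))
  simp only [Function.comp_apply] at h1 hprod
  rw [hprod, ← h2] at h1
  exact mul_right_cancel₀ (normSign_ne_zero σ (D (π i))) h1

/-- **THE κ-SIGN OF A RE-INDEXED SET OF FORMS**: `cosetKappa σ i ((· ∘ π) '' C) = cosetKappa σ (π i) C`. [cite: LanglandsShelstad1987, §3] [cite: Kottwitz1986BaseChangeUnits, §1 pp. 240–241] -/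
theorem cosetKappa_image_comp_perm (σ : K →+* K) (π : Equiv.Perm (Fin 3)) (i : Fin 3) (C : Set (Fin 3 → K)) :
    cosetKappa σ i ((fun D : Fin 3 → K => D ∘ ⇑π) '' C) = cosetKappa σ (π i) C := by
  have hall : ∀ e : ℤ, (∀ E ∈ (fun D : Fin 3 → K => D ∘ ⇑π) '' C, chiVec σ i E = e) ↔ ∀ D ∈ C, chiVec σ (π i) D = e := by
    intro e
    constructor
    · intro h D hD
      rw [← chiVec_comp_perm σ π i D]
      exact h _ ⟨D, hD, rfl⟩
    · rintro h E ⟨D, hD, rfl⟩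
      rw [chiVec_comp_perm σ π i D]
      exact h D hD
  rw [cosetKappa_eq, cosetKappa_eq]
  by_cases h1 : ∀ D ∈ C, chiVec σ (π i) D = 1
  · rw [if_pos h1, if_pos ((hall 1).2 h1)]
  · rw [if_neg h1, if_neg (fun h => h1 ((hall 1).1 h))]
    by_cases h2 : ∀ D ∈ C, chiVec σ (π i) D = -1
    · rw [if_pos h2, if_pos ((hall (-1)).2 h2)]
    · rw [if_neg h2, if_neg (fun h => h2 ((hall (-1)).1 h))]

end Chi

/-! ## §2  `kappaCount` under a coordinate permutation -/

section Kappa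

variable {K : Type} [Field K] [Valued K ℤᵐ⁰]

/-- **`kappaCount σ ϖ tv i (P·M) = kappaCount σ ϖ tv (π i) M`** (`P` the matrix of `π`, any type `tv`): the cosets of `M` are the images `D ↦ D ∘ π⁻¹` of the cosets of `P·M`
(★ §P₂ ED. 2 `image_polarisationCosets_mapGL_perm`), and the κ-sign of the image in slot `π i` is the κ-sign of the coset in slot `i` (§1 at `π⁻¹`).
[cite: Kottwitz1986BaseChangeUnits, §1 pp. 240–241] [cite: LanglandsShelstad1987, §3] [cite: Rogawski1990, §4.9 Prop. 4.9.1 (a) p. 55] -/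
theorem kappaCount_mapGL_perm (σ : K →+* K) (ϖ : K) {π : Equiv.Perm (Fin 3)} (P : GL (Fin 3) K)
    (hP : (P : Matrix (Fin 3) (Fin 3) K) = π.permMatrix K) (tv : ℕ) (i : Fin 3) (M : Submodule 𝒪[K] (Fin 3 → K)) :
    kappaCount σ ϖ tv i (mapGL P M) = kappaCount σ ϖ tv (π i) M := by
  have hinj : Function.Injective (fun D : Fin 3 → K => D ∘ ⇑π.symm) := fun D₁ D₂ h => by
    have h' := congrArg (fun E : Fin 3 → K => E ∘ ⇑π) h
    simpa only [Function.comp_assoc, Equiv.symm_comp_self, Function.comp_id] using h'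
  rw [kappaCount_eq, kappaCount_eq, ← image_polarisationCosets_mapGL_perm σ ϖ P hP tv M,
    finsum_mem_image (Set.image_injective.2 hinj).injOn]
  refine finsum_mem_congr rfl fun C _ => ?_
  rw [cosetKappa_image_comp_perm σ π.symm (π i) C, Equiv.symm_apply_apply]

/-- The signed weight `κ_i·w` is slot-EQUIVARIANT under a coordinate permutation: `κ_i(P·M)·w(P·M) = κ_{π i}(M)·w(M)` (★ §P `stabiliserWeight_mapGL_perm`).
[cite: Kottwitz1986BaseChangeUnits, §1 pp. 240–241] -/
theorem kappaCount_mul_stabiliserWeight_mapGL_perm (σ : K →+* K) (ϖ : K) {π : Equiv.Perm (Fin 3)} (P : GL (Fin 3) K)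
    (hP : (P : Matrix (Fin 3) (Fin 3) K) = π.permMatrix K) (tv : ℕ) (i : Fin 3) (M : Submodule 𝒪[K] (Fin 3 → K)) :
    (kappaCount σ ϖ tv i (mapGL P M) : ℚ) * stabiliserWeight σ (mapGL P M) = (kappaCount σ ϖ tv (π i) M : ℚ) * stabiliserWeight σ M := by
  rw [kappaCount_mapGL_perm σ ϖ P hP, stabiliserWeight_mapGL_perm σ P hP]

end Kappa

/-! ## §3  Equivariant transport over a stratum (types 0 and 2) -/

section Transport

variable {K : Type} [Field K] [Valued K ℤᵐ⁰] {N : ℕ}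

/-- **EQUIVARIANT TRANSPORT, TYPE 0**: if `f (P·M) = g M` for all `M`, then `Σᶠ_{M ∈ stratum(T,a)} f M = Σᶠ_{M ∈ stratum(P⁻¹TP, a ∘ π⁻¹)} g M` (★ §P `image_mapGL_stratum`).
[cite: Kottwitz1986BaseChangeUnits, §1 pp. 240–241] -/
theorem finsum_mem_stratum_perm_of_mapGL (σ : K →+* K) (ϖ : K) {π : Equiv.Perm (Fin N)} (P : GL (Fin N) K)
    (hP : (P : Matrix (Fin N) (Fin N) K) = π.permMatrix K) (T : GL (Fin N) K) (a : Fin N → ℕ) {R : Type*} [AddCommMonoid R]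
    (f g : Submodule 𝒪[K] (Fin N → K) → R) (hfg : ∀ M, f (mapGL P M) = g M) :
    ∑ᶠ M ∈ stratum σ ϖ T a, f M = ∑ᶠ M ∈ stratum σ ϖ (P⁻¹ * T * P) (a ∘ ⇑π.symm), g M := by
  rw [← image_mapGL_stratum σ ϖ P hP T a, finsum_mem_image (mapGL_injective P).injOn]
  exact finsum_mem_congr rfl fun M _ => hfg M

/-- **EQUIVARIANT TRANSPORT, TYPE 2**: if `f (P·M) = g M` for all `M`, then `Σᶠ_{M ∈ stratumTwo(T,a)} f M = Σᶠ_{M ∈ stratumTwo(P⁻¹TP, a ∘ π⁻¹)} g M` (★ §P₂ `image_mapGL_stratumTwo`).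
[cite: Kottwitz1986BaseChangeUnits, §1 pp. 240–241] -/
theorem finsum_mem_stratumTwo_perm_of_mapGL (σ : K →+* K) (ϖ : K) {π : Equiv.Perm (Fin N)} (P : GL (Fin N) K)
    (hP : (P : Matrix (Fin N) (Fin N) K) = π.permMatrix K) (T : GL (Fin N) K) (a : Fin N → ℕ) {R : Type*} [AddCommMonoid R]
    (f g : Submodule 𝒪[K] (Fin N → K) → R) (hfg : ∀ M, f (mapGL P M) = g M) :
    ∑ᶠ M ∈ stratumTwo σ ϖ T a, f M = ∑ᶠ M ∈ stratumTwo σ ϖ (P⁻¹ * T * P) (a ∘ ⇑π.symm), g M := by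
  rw [← image_mapGL_stratumTwo σ ϖ P hP T a, finsum_mem_image (mapGL_injective P).injOn]
  exact finsum_mem_congr rfl fun M _ => hfg M

end Transport

section KappaTransport

variable {K : Type} [Field K] [Valued K ℤᵐ⁰]

/-- **THE κ-WEIGHTED COUNT OF A TYPE-0 STRATUM MOVES WITH ITS SLOT**: `Σᶠ_{M ∈ stratum(T,a)} κ_i(M)·w(M) = Σᶠ_{M ∈ stratum(P⁻¹TP, a∘π⁻¹)} κ_{π i}(M)·w(M)` (any `tv`).
[cite: Kottwitz1986BaseChangeUnits, §1 pp. 240–241] [cite: Rogawski1990, §4.9 Prop. 4.9.1 (a) p. 55] -/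
theorem finsum_kappaCount_mul_stabiliserWeight_stratum_perm (σ : K →+* K) (ϖ : K) {π : Equiv.Perm (Fin 3)} (P : GL (Fin 3) K)
    (hP : (P : Matrix (Fin 3) (Fin 3) K) = π.permMatrix K) (T : GL (Fin 3) K) (a : Fin 3 → ℕ) (tv : ℕ) (i : Fin 3) :
    ∑ᶠ M ∈ stratum σ ϖ T a, (kappaCount σ ϖ tv i M : ℚ) * stabiliserWeight σ M =
      ∑ᶠ M ∈ stratum σ ϖ (P⁻¹ * T * P) (a ∘ ⇑π.symm), (kappaCount σ ϖ tv (π i) M : ℚ) * stabiliserWeight σ M :=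
  finsum_mem_stratum_perm_of_mapGL σ ϖ P hP T a _ _ fun M => kappaCount_mul_stabiliserWeight_mapGL_perm σ ϖ P hP tv i M

/-- **THE κ-WEIGHTED COUNT OF A TYPE-2 STRATUM MOVES WITH ITS SLOT**: `Σᶠ_{M ∈ stratumTwo(T,a)} κ_i(M)·w(M) = Σᶠ_{M ∈ stratumTwo(P⁻¹TP, a∘π⁻¹)} κ_{π i}(M)·w(M)` (any `tv`).
[cite: Kottwitz1986BaseChangeUnits, §1 pp. 240–241] [cite: Rogawski1990, §4.9 Prop. 4.9.1 (a) p. 55] -/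
theorem finsum_kappaCount_mul_stabiliserWeight_stratumTwo_perm (σ : K →+* K) (ϖ : K) {π : Equiv.Perm (Fin 3)} (P : GL (Fin 3) K)
    (hP : (P : Matrix (Fin 3) (Fin 3) K) = π.permMatrix K) (T : GL (Fin 3) K) (a : Fin 3 → ℕ) (tv : ℕ) (i : Fin 3) :
    ∑ᶠ M ∈ stratumTwo σ ϖ T a, (kappaCount σ ϖ tv i M : ℚ) * stabiliserWeight σ M =
      ∑ᶠ M ∈ stratumTwo σ ϖ (P⁻¹ * T * P) (a ∘ ⇑π.symm), (kappaCount σ ϖ tv (π i) M : ℚ) * stabiliserWeight σ M :=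
  finsum_mem_stratumTwo_perm_of_mapGL σ ϖ P hP T a _ _ fun M => kappaCount_mul_stabiliserWeight_mapGL_perm σ ϖ P hP tv i M

end KappaTransport

/-! ## §4  The slot-permuting adapters (head of any shape, abstracted as a slot vector `F` under a side condition `Hyp`) -/

section Adapters

variable {K : Type} [Field K] [Valued K ℤᵐ⁰] {σ : K →+* K} {ϖ : K} {α β : K} {N₀ n₁ n₂ n₃ : ℕ} {T : GL (Fin 3) K}

/-- The unit rescaling for the swap `(0 2)`: a `GL`-element with matrix `diag(α⁻¹, βα⁻¹, 1) = α⁻¹ • (P⁻¹TP)` (`P⁻¹TP = diag(1, β, α)`, ★ §P `coe_conj_eq_diagonal`).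
[cite: Kottwitz1986BaseChangeUnits, §1 pp. 240–241] -/
theorem exists_gl_rescale_swap02 (hE : IsElementDatum σ ϖ N₀ α β n₁ n₂ n₃) (hT : (T : Matrix (Fin 3) (Fin 3) K) = Matrix.diagonal ![α, β, 1])
    (P : GL (Fin 3) K) (hP : (P : Matrix (Fin 3) (Fin 3) K) = (Equiv.swap (0 : Fin 3) 2).permMatrix K) :
    ∃ T'' : GL (Fin 3) K, (T'' : Matrix (Fin 3) (Fin 3) K) = Matrix.diagonal ![α⁻¹, β * α⁻¹, 1] ∧
      (T'' : Matrix (Fin 3) (Fin 3) K) = α⁻¹ • ((P⁻¹ * T * P : GL (Fin 3) K) : Matrix (Fin 3) (Fin 3) K) := by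
  have hα : α * σ α = 1 := hE.1
  have hα0 : α ≠ 0 := fun h => by rw [h, zero_mul] at hα; exact zero_ne_one hα
  have hβ0 : β ≠ 0 := fun h => by have := hE.2.1; rw [h, zero_mul] at this; exact zero_ne_one this
  have hdet : (Matrix.diagonal ![α⁻¹, β * α⁻¹, 1] : Matrix (Fin 3) (Fin 3) K).det ≠ 0 := by
    rw [Matrix.det_diagonal, Fin.prod_univ_three]
    simp [hα0, hβ0]
  have hd : (![α, β, 1] : Fin 3 → K) ∘ ⇑(Equiv.swap (0 : Fin 3) 2).symm = ![1, β, α] := by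
    ext i; fin_cases i <;> rfl
  have hconj := coe_conj_eq_diagonal P hP T hT
  rw [hd] at hconj
  refine ⟨Matrix.GeneralLinearGroup.mkOfDetNeZero _ hdet, rfl, ?_⟩
  rw [hconj, ← Matrix.diagonal_smul]
  show Matrix.diagonal ![α⁻¹, β * α⁻¹, 1] = _
  congr 1
  ext i; fin_cases i
  · simp
  · simp [mul_comm]
  · simp [inv_mul_cancel₀ hα0]

/-- **ADAPTER `(a,b,c) ↦ (b,a,c)`, TYPE 0, κ-weighted**: if at every element datum `(α′, β′; n′)` satisfying `Hyp α′ β′ n′` the slot-`i` κ-count of `stratum(T′, (a,b,c))` is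
`F α′ β′ n′ i`, then at a datum whose SWAPPED letters satisfy `Hyp β α n₂ n₁ n₃` the slot-`i` κ-count of `stratum(T, (b,a,c))` is `F β α n₂ n₁ n₃ (swap 0 1 i)` — the swap `(0 1)`:
`diag(α,β,1) ↦ diag(β,α,1)` (★ `isElementDatum_swap`), slots permuted by §3. [cite: Kottwitz1986BaseChangeUnits, §1 pp. 240–241] [cite: Rogawski1990, §4.9 Prop. 4.9.1 (a) p. 55] -/
theorem finsum_kappaCount_mul_stabiliserWeight_stratum_swap01_of (hE : IsElementDatum σ ϖ N₀ α β n₁ n₂ n₃)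
    (hT : (T : Matrix (Fin 3) (Fin 3) K) = Matrix.diagonal ![α, β, 1]) (tv a b c : ℕ)
    (Hyp : K → K → ℕ → ℕ → ℕ → Prop) (F : K → K → ℕ → ℕ → ℕ → Fin 3 → ℚ)
    (hG1 : ∀ {α' β' : K} {n₁' n₂' n₃' : ℕ} (T' : GL (Fin 3) K), IsElementDatum σ ϖ N₀ α' β' n₁' n₂' n₃' →
      (T' : Matrix (Fin 3) (Fin 3) K) = Matrix.diagonal ![α', β', 1] → Hyp α' β' n₁' n₂' n₃' →
        ∀ i : Fin 3, ∑ᶠ M ∈ stratum σ ϖ T' ![a, b, c], (kappaCount σ ϖ tv i M : ℚ) * stabiliserWeight σ M = F α' β' n₁' n₂' n₃' i)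
    (hHyp : Hyp β α n₂ n₁ n₃) (i : Fin 3) :
    ∑ᶠ M ∈ stratum σ ϖ T ![b, a, c], (kappaCount σ ϖ tv i M : ℚ) * stabiliserWeight σ M = F β α n₂ n₁ n₃ (Equiv.swap (0 : Fin 3) 1 i) := by
  obtain ⟨P, hP⟩ := exists_gl_coe_eq_permMatrix (K := K) (Equiv.swap (0 : Fin 3) 1)
  rw [finsum_kappaCount_mul_stabiliserWeight_stratum_perm σ ϖ P hP T _ tv i]
  have ha : (![b, a, c] : Fin 3 → ℕ) ∘ ⇑(Equiv.swap (0 : Fin 3) 1).symm = ![a, b, c] := by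
    ext i; fin_cases i <;> rfl
  have hd : (![α, β, 1] : Fin 3 → K) ∘ ⇑(Equiv.swap (0 : Fin 3) 1).symm = ![β, α, 1] := by
    ext i; fin_cases i <;> rfl
  rw [ha]
  exact hG1 _ (isElementDatum_swap hE) (by rw [coe_conj_eq_diagonal P hP T hT, hd]) hHyp _

/-- **ADAPTER `(a,b,c) ↦ (c,b,a)`, TYPE 0, κ-weighted**: the swap `(0 2)` followed by the unit rescaling `α⁻¹` — datum `(α⁻¹, βα⁻¹)`, depths `(n₃, n₂, n₁)` (★ `isElementDatum_rescale`,
★ `stratum_eq_of_coe_eq_smul`); value `F α⁻¹ (βα⁻¹) n₃ n₂ n₁ (swap 0 2 i)` under `Hyp α⁻¹ (βα⁻¹) n₃ n₂ n₁`. [cite: Kottwitz1986BaseChangeUnits, §1 pp. 240–241] [cite: Rogawski1990, §4.9 Prop. 4.9.1 (a) p. 55] -/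
theorem finsum_kappaCount_mul_stabiliserWeight_stratum_swap02_of (hvσ : ∀ x, Valued.v (σ x) = Valued.v x) (hE : IsElementDatum σ ϖ N₀ α β n₁ n₂ n₃)
    (hT : (T : Matrix (Fin 3) (Fin 3) K) = Matrix.diagonal ![α, β, 1]) (tv a b c : ℕ)
    (Hyp : K → K → ℕ → ℕ → ℕ → Prop) (F : K → K → ℕ → ℕ → ℕ → Fin 3 → ℚ)
    (hG1 : ∀ {α' β' : K} {n₁' n₂' n₃' : ℕ} (T' : GL (Fin 3) K), IsElementDatum σ ϖ N₀ α' β' n₁' n₂' n₃' →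
      (T' : Matrix (Fin 3) (Fin 3) K) = Matrix.diagonal ![α', β', 1] → Hyp α' β' n₁' n₂' n₃' →
        ∀ i : Fin 3, ∑ᶠ M ∈ stratum σ ϖ T' ![a, b, c], (kappaCount σ ϖ tv i M : ℚ) * stabiliserWeight σ M = F α' β' n₁' n₂' n₃' i)
    (hHyp : Hyp α⁻¹ (β * α⁻¹) n₃ n₂ n₁) (i : Fin 3) :
    ∑ᶠ M ∈ stratum σ ϖ T ![c, b, a], (kappaCount σ ϖ tv i M : ℚ) * stabiliserWeight σ M = F α⁻¹ (β * α⁻¹) n₃ n₂ n₁ (Equiv.swap (0 : Fin 3) 2 i) := by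
  have hα : α * σ α = 1 := hE.1
  have hvα : Valued.v α = 1 := by
    have h : Valued.v α * Valued.v α = 1 := by nth_rw 2 [← hvσ α]; rw [← map_mul, hα, map_one]
    rw [← pow_two] at h
    exact ((pow_eq_one_iff).1 h).resolve_right two_ne_zero
  obtain ⟨P, hP⟩ := exists_gl_coe_eq_permMatrix (K := K) (Equiv.swap (0 : Fin 3) 2)
  rw [finsum_kappaCount_mul_stabiliserWeight_stratum_perm σ ϖ P hP T _ tv i]
  have ha : (![c, b, a] : Fin 3 → ℕ) ∘ ⇑(Equiv.swap (0 : Fin 3) 2).symm = ![a, b, c] := by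
    ext i; fin_cases i <;> rfl
  rw [ha]
  obtain ⟨T'', hT'', hTT⟩ := exists_gl_rescale_swap02 hE hT P hP
  rw [← stratum_eq_of_coe_eq_smul σ ϖ (by rw [map_inv₀, hvα, inv_one]) hTT]
  exact hG1 _ (isElementDatum_rescale hvσ hE) hT'' hHyp _

/-- **ADAPTER `(a,b,c) ↦ (b,a,c)`, TYPE 2, κ-weighted** (`stratumTwo`; as the type-0 one). [cite: Kottwitz1986BaseChangeUnits, §1 pp. 240–241] [cite: Rogawski1990, §4.9 Prop. 4.9.1 (a) p. 55] -/
theorem finsum_kappaCount_mul_stabiliserWeight_stratumTwo_swap01_of (hE : IsElementDatum σ ϖ N₀ α β n₁ n₂ n₃)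
    (hT : (T : Matrix (Fin 3) (Fin 3) K) = Matrix.diagonal ![α, β, 1]) (tv a b c : ℕ)
    (Hyp : K → K → ℕ → ℕ → ℕ → Prop) (F : K → K → ℕ → ℕ → ℕ → Fin 3 → ℚ)
    (hG1 : ∀ {α' β' : K} {n₁' n₂' n₃' : ℕ} (T' : GL (Fin 3) K), IsElementDatum σ ϖ N₀ α' β' n₁' n₂' n₃' →
      (T' : Matrix (Fin 3) (Fin 3) K) = Matrix.diagonal ![α', β', 1] → Hyp α' β' n₁' n₂' n₃' →
        ∀ i : Fin 3, ∑ᶠ M ∈ stratumTwo σ ϖ T' ![a, b, c], (kappaCount σ ϖ tv i M : ℚ) * stabiliserWeight σ M = F α' β' n₁' n₂' n₃' i)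
    (hHyp : Hyp β α n₂ n₁ n₃) (i : Fin 3) :
    ∑ᶠ M ∈ stratumTwo σ ϖ T ![b, a, c], (kappaCount σ ϖ tv i M : ℚ) * stabiliserWeight σ M = F β α n₂ n₁ n₃ (Equiv.swap (0 : Fin 3) 1 i) := by
  obtain ⟨P, hP⟩ := exists_gl_coe_eq_permMatrix (K := K) (Equiv.swap (0 : Fin 3) 1)
  rw [finsum_kappaCount_mul_stabiliserWeight_stratumTwo_perm σ ϖ P hP T _ tv i]
  have ha : (![b, a, c] : Fin 3 → ℕ) ∘ ⇑(Equiv.swap (0 : Fin 3) 1).symm = ![a, b, c] := by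
    ext i; fin_cases i <;> rfl
  have hd : (![α, β, 1] : Fin 3 → K) ∘ ⇑(Equiv.swap (0 : Fin 3) 1).symm = ![β, α, 1] := by
    ext i; fin_cases i <;> rfl
  rw [ha]
  exact hG1 _ (isElementDatum_swap hE) (by rw [coe_conj_eq_diagonal P hP T hT, hd]) hHyp _

/-- **ADAPTER `(a,b,c) ↦ (c,b,a)`, TYPE 2, κ-weighted** (`stratumTwo`; swap `(0 2)` + unit rescaling `α⁻¹`, ★ `stratumTwo_eq_of_coe_eq_smul`).
[cite: Kottwitz1986BaseChangeUnits, §1 pp. 240–241] [cite: Rogawski1990, §4.9 Prop. 4.9.1 (a) p. 55] -/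
theorem finsum_kappaCount_mul_stabiliserWeight_stratumTwo_swap02_of (hvσ : ∀ x, Valued.v (σ x) = Valued.v x) (hE : IsElementDatum σ ϖ N₀ α β n₁ n₂ n₃)
    (hT : (T : Matrix (Fin 3) (Fin 3) K) = Matrix.diagonal ![α, β, 1]) (tv a b c : ℕ)
    (Hyp : K → K → ℕ → ℕ → ℕ → Prop) (F : K → K → ℕ → ℕ → ℕ → Fin 3 → ℚ)
    (hG1 : ∀ {α' β' : K} {n₁' n₂' n₃' : ℕ} (T' : GL (Fin 3) K), IsElementDatum σ ϖ N₀ α' β' n₁' n₂' n₃' →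
      (T' : Matrix (Fin 3) (Fin 3) K) = Matrix.diagonal ![α', β', 1] → Hyp α' β' n₁' n₂' n₃' →
        ∀ i : Fin 3, ∑ᶠ M ∈ stratumTwo σ ϖ T' ![a, b, c], (kappaCount σ ϖ tv i M : ℚ) * stabiliserWeight σ M = F α' β' n₁' n₂' n₃' i)
    (hHyp : Hyp α⁻¹ (β * α⁻¹) n₃ n₂ n₁) (i : Fin 3) :
    ∑ᶠ M ∈ stratumTwo σ ϖ T ![c, b, a], (kappaCount σ ϖ tv i M : ℚ) * stabiliserWeight σ M = F α⁻¹ (β * α⁻¹) n₃ n₂ n₁ (Equiv.swap (0 : Fin 3) 2 i) := by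
  have hα : α * σ α = 1 := hE.1
  have hvα : Valued.v α = 1 := by
    have h : Valued.v α * Valued.v α = 1 := by nth_rw 2 [← hvσ α]; rw [← map_mul, hα, map_one]
    rw [← pow_two] at h
    exact ((pow_eq_one_iff).1 h).resolve_right two_ne_zero
  obtain ⟨P, hP⟩ := exists_gl_coe_eq_permMatrix (K := K) (Equiv.swap (0 : Fin 3) 2)
  rw [finsum_kappaCount_mul_stabiliserWeight_stratumTwo_perm σ ϖ P hP T _ tv i]
  have ha : (![c, b, a] : Fin 3 → ℕ) ∘ ⇑(Equiv.swap (0 : Fin 3) 2).symm = ![a, b, c] := by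
    ext i; fin_cases i <;> rfl
  rw [ha]
  obtain ⟨T'', hT'', hTT⟩ := exists_gl_rescale_swap02 hE hT P hP
  rw [← stratumTwo_eq_of_coe_eq_smul σ ϖ (by rw [map_inv₀, hvα, inv_one]) hTT]
  exact hG1 _ (isElementDatum_rescale hvσ hE) hT'' hHyp _

/-! ### The named G-instances: `(r, r+s, r+s) ↦ (r+s, r, r+s)` (foot on `B₂`) and `↦ (r+s, r+s, r)` (foot on `B₃`); `r = 2ρ` (type 0), `r = 2ρ+1` (type 2) -/

/-- **κ-SOCKET G₂, TYPE 0 — GLUED, FOOT ON `B₂`, axis `(r+s, r, r+s)`** from a `B₁`-footed κ-head `(r, r+s, r+s)` valid at every datum under `Hyp`: value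
`F β α n₂ n₁ n₃ (swap 0 1 i)` (slot 0 ↔ slot 1; e.g. from ★ p856706 `finsum_kappaCount_mul_stabiliserWeight_hasAxis_G1` at `r = 2ρ`). [cite: Kottwitz1986BaseChangeUnits, §1 pp. 240–241] [cite: Rogawski1990, §4.9 Prop. 4.9.1 (a) p. 55] -/
theorem finsum_kappaCount_mul_stabiliserWeight_stratum_G2_of_G1 (hE : IsElementDatum σ ϖ N₀ α β n₁ n₂ n₃)
    (hT : (T : Matrix (Fin 3) (Fin 3) K) = Matrix.diagonal ![α, β, 1]) (tv r s : ℕ)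
    (Hyp : K → K → ℕ → ℕ → ℕ → Prop) (F : K → K → ℕ → ℕ → ℕ → Fin 3 → ℚ)
    (hG1 : ∀ {α' β' : K} {n₁' n₂' n₃' : ℕ} (T' : GL (Fin 3) K), IsElementDatum σ ϖ N₀ α' β' n₁' n₂' n₃' →
      (T' : Matrix (Fin 3) (Fin 3) K) = Matrix.diagonal ![α', β', 1] → Hyp α' β' n₁' n₂' n₃' →
        ∀ i : Fin 3, ∑ᶠ M ∈ stratum σ ϖ T' ![r, r + s, r + s], (kappaCount σ ϖ tv i M : ℚ) * stabiliserWeight σ M = F α' β' n₁' n₂' n₃' i)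
    (hHyp : Hyp β α n₂ n₁ n₃) (i : Fin 3) :
    ∑ᶠ M ∈ stratum σ ϖ T ![r + s, r, r + s], (kappaCount σ ϖ tv i M : ℚ) * stabiliserWeight σ M = F β α n₂ n₁ n₃ (Equiv.swap (0 : Fin 3) 1 i) :=
  finsum_kappaCount_mul_stabiliserWeight_stratum_swap01_of hE hT tv r (r + s) (r + s) Hyp F hG1 hHyp i

/-- **κ-SOCKET G₃, TYPE 0 — GLUED, FOOT ON `B₃`, axis `(r+s, r+s, r)`** from the `B₁`-footed κ-head at every datum under `Hyp`: value `F α⁻¹ (βα⁻¹) n₃ n₂ n₁ (swap 0 2 i)`.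
[cite: Kottwitz1986BaseChangeUnits, §1 pp. 240–241] [cite: Rogawski1990, §4.9 Prop. 4.9.1 (a) p. 55] -/
theorem finsum_kappaCount_mul_stabiliserWeight_stratum_G3_of_G1 (hvσ : ∀ a, Valued.v (σ a) = Valued.v a) (hE : IsElementDatum σ ϖ N₀ α β n₁ n₂ n₃)
    (hT : (T : Matrix (Fin 3) (Fin 3) K) = Matrix.diagonal ![α, β, 1]) (tv r s : ℕ)
    (Hyp : K → K → ℕ → ℕ → ℕ → Prop) (F : K → K → ℕ → ℕ → ℕ → Fin 3 → ℚ)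
    (hG1 : ∀ {α' β' : K} {n₁' n₂' n₃' : ℕ} (T' : GL (Fin 3) K), IsElementDatum σ ϖ N₀ α' β' n₁' n₂' n₃' →
      (T' : Matrix (Fin 3) (Fin 3) K) = Matrix.diagonal ![α', β', 1] → Hyp α' β' n₁' n₂' n₃' →
        ∀ i : Fin 3, ∑ᶠ M ∈ stratum σ ϖ T' ![r, r + s, r + s], (kappaCount σ ϖ tv i M : ℚ) * stabiliserWeight σ M = F α' β' n₁' n₂' n₃' i)
    (hHyp : Hyp α⁻¹ (β * α⁻¹) n₃ n₂ n₁) (i : Fin 3) :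
    ∑ᶠ M ∈ stratum σ ϖ T ![r + s, r + s, r], (kappaCount σ ϖ tv i M : ℚ) * stabiliserWeight σ M = F α⁻¹ (β * α⁻¹) n₃ n₂ n₁ (Equiv.swap (0 : Fin 3) 2 i) :=
  finsum_kappaCount_mul_stabiliserWeight_stratum_swap02_of hvσ hE hT tv r (r + s) (r + s) Hyp F hG1 hHyp i

/-- **κ-SOCKET G₂, TYPE 2 — GLUED, FOOT ON `B₂`, axis `(r+s, r, r+s)`** (`stratumTwo`, `r = 2ρ+1` for the glued type-2 strata; from F0P3-p01 (g31)'s G₁-κ head at every datum under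
`Hyp`): value `F β α n₂ n₁ n₃ (swap 0 1 i)`. [cite: Kottwitz1986BaseChangeUnits, §1 pp. 240–241] [cite: Rogawski1990, §4.9 Prop. 4.9.1 (a) p. 55] -/
theorem finsum_kappaCount_mul_stabiliserWeight_stratumTwo_G2_of_G1 (hE : IsElementDatum σ ϖ N₀ α β n₁ n₂ n₃)
    (hT : (T : Matrix (Fin 3) (Fin 3) K) = Matrix.diagonal ![α, β, 1]) (tv r s : ℕ)
    (Hyp : K → K → ℕ → ℕ → ℕ → Prop) (F : K → K → ℕ → ℕ → ℕ → Fin 3 → ℚ)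
    (hG1 : ∀ {α' β' : K} {n₁' n₂' n₃' : ℕ} (T' : GL (Fin 3) K), IsElementDatum σ ϖ N₀ α' β' n₁' n₂' n₃' →
      (T' : Matrix (Fin 3) (Fin 3) K) = Matrix.diagonal ![α', β', 1] → Hyp α' β' n₁' n₂' n₃' →
        ∀ i : Fin 3, ∑ᶠ M ∈ stratumTwo σ ϖ T' ![r, r + s, r + s], (kappaCount σ ϖ tv i M : ℚ) * stabiliserWeight σ M = F α' β' n₁' n₂' n₃' i)
    (hHyp : Hyp β α n₂ n₁ n₃) (i : Fin 3) :
    ∑ᶠ M ∈ stratumTwo σ ϖ T ![r + s, r, r + s], (kappaCount σ ϖ tv i M : ℚ) * stabiliserWeight σ M = F β α n₂ n₁ n₃ (Equiv.swap (0 : Fin 3) 1 i) :=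
  finsum_kappaCount_mul_stabiliserWeight_stratumTwo_swap01_of hE hT tv r (r + s) (r + s) Hyp F hG1 hHyp i

/-- **κ-SOCKET G₃, TYPE 2 — GLUED, FOOT ON `B₃`, axis `(r+s, r+s, r)`** (`stratumTwo`): value `F α⁻¹ (βα⁻¹) n₃ n₂ n₁ (swap 0 2 i)`.
[cite: Kottwitz1986BaseChangeUnits, §1 pp. 240–241] [cite: Rogawski1990, §4.9 Prop. 4.9.1 (a) p. 55] -/
theorem finsum_kappaCount_mul_stabiliserWeight_stratumTwo_G3_of_G1 (hvσ : ∀ a, Valued.v (σ a) = Valued.v a) (hE : IsElementDatum σ ϖ N₀ α β n₁ n₂ n₃)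
    (hT : (T : Matrix (Fin 3) (Fin 3) K) = Matrix.diagonal ![α, β, 1]) (tv r s : ℕ)
    (Hyp : K → K → ℕ → ℕ → ℕ → Prop) (F : K → K → ℕ → ℕ → ℕ → Fin 3 → ℚ)
    (hG1 : ∀ {α' β' : K} {n₁' n₂' n₃' : ℕ} (T' : GL (Fin 3) K), IsElementDatum σ ϖ N₀ α' β' n₁' n₂' n₃' →
      (T' : Matrix (Fin 3) (Fin 3) K) = Matrix.diagonal ![α', β', 1] → Hyp α' β' n₁' n₂' n₃' →
        ∀ i : Fin 3, ∑ᶠ M ∈ stratumTwo σ ϖ T' ![r, r + s, r + s], (kappaCount σ ϖ tv i M : ℚ) * stabiliserWeight σ M = F α' β' n₁' n₂' n₃' i)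
    (hHyp : Hyp α⁻¹ (β * α⁻¹) n₃ n₂ n₁) (i : Fin 3) :
    ∑ᶠ M ∈ stratumTwo σ ϖ T ![r + s, r + s, r], (kappaCount σ ϖ tv i M : ℚ) * stabiliserWeight σ M = F α⁻¹ (β * α⁻¹) n₃ n₂ n₁ (Equiv.swap (0 : Fin 3) 2 i) :=
  finsum_kappaCount_mul_stabiliserWeight_stratumTwo_swap02_of hvσ hE hT tv r (r + s) (r + s) Hyp F hG1 hHyp i

end Adapters

end Summit.HodgeConjecture.HodgeConjecture.Cruxes.H413.F0P3cDyRamDiagonalKappaPermutation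

end
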